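import Mathlib
import HarnessLib
import Summits.CriticalPhenomena.Ising3DConformalLimit.Theses.FKParityRobustness
import Literature.Probability.LatticeModels.RandomCluster
import Literature.Probability.LatticeModels.LoopO1

/-!
# Sketch — first lemmas of two crux ideas for `FKParityRobustness.FKFourConnectivity`
(crux-ideate stmt-CriticalPhenomena-11254, ideator 2, round 1). Statements only (sorried):
they must ELABORATE over existing declarations; proofs are for the crux-plan / prover stage.

* Idea `loop-cluster-adjacency-surgery`: `trailContactSurgery` (one-edge surgery with multiplicity
  one) and the transfer target `LoopClustersTouch` (sourced loop-O(1) clusters touch or join).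
* Idea `disjoint-crossing-tails`: `disjointCrossingTail` (free-measure cluster-BK by induction) and
  `twoArmGluing` (the k = 2 pointed version: distinct arms cost the product).
-/

noncomputable section

namespace Summit.CriticalPhenomena.Ising3DConformalLimit.Cruxes.FKFourConnectivity.Sketch

open MeasureTheory Literature.Probability.LatticeModels Literature.Probability.Percolation

/-- The regular lattice tetrahedron of the route (even corners of the cube `[-1,1]³`). -/
def tetra : Fin 4 → Site 3 := ![![-1, -1, -1], ![1, 1, -1], ![1, -1, 1], ![-1, 1, 1]]

/-- Box vertex type and its nearest-neighbour graph (the crux's finite-volume setting). -/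
abbrev BoxV (N : ℕ) : Type := ↥(box 3 N)

/-- The nearest-neighbour graph induced on `Λ_N` (as in the crux). -/
def boxGraph (N : ℕ) : SimpleGraph (BoxV N) := (zdGraph 3).comap Subtype.val

instance (N : ℕ) : DecidableRel (boxGraph N).Adj := fun x y =>
  inferInstanceAs (Decidable ((zdGraph 3).Adj x.1 y.1))

/-- The free critical FK-Ising measure of the box (exactly the crux's `φ`). -/
noncomputable def phiN (N : ℕ) : Measure (BondConfig (BoxV N)) :=
  rcMeasure (boxGraph N) (fkIsingParam (criticalBeta 3)) 2 ∅

/-- `u` lies on an OPEN edge-simple trail from `x` to `y` in the configuration `ω`. By Euler's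
theorem this holds for every vertex of a connected open subgraph whose only odd-degree vertices
are `x, y` (e.g. the `x`-component of a T-join of the sources). -/
def OnOpenTrail {V : Type*} (ω : BondConfig V) (x y u : V) : Prop :=
  ∃ w : (openGraph ω).Walk x y, w.IsTrail ∧ u ∈ w.support

/-- The `(01|23)`-split event: both pairs joined, the two pair-clusters distinct. -/
def Split {V : Type*} (ω : BondConfig V) (a : Fin 4 → V) : Prop :=
  (openGraph ω).Reachable (a 0) (a 1) ∧ (openGraph ω).Reachable (a 2) (a 3) ∧
    ¬ (openGraph ω).Reachable (a 0) (a 2)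

/-- All four points in one open cluster. -/
def AllJoined {V : Type*} (ω : BondConfig V) (a : Fin 4 → V) : Prop :=
  ∀ i j, (openGraph ω).Reachable (a i) (a j)

/-- A closed edge `{u,v}` of `G` joining a point of an open `a0→a1` trail to a point of an open
`a2→a3` trail ("trail-to-trail contact"). -/
def TrailContact {V : Type*} (G : SimpleGraph V) (ω : BondConfig V) (a : Fin 4 → V) : Prop :=
  ∃ u v : V, G.Adj u v ∧ s(u, v) ∉ ω ∧ OnOpenTrail ω (a 0) (a 1) u ∧ OnOpenTrail ω (a 2) (a 3) v

/-- **First lemma of idea `loop-cluster-adjacency-surgery` (one-edge surgery, multiplicity one).**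
For the free random-cluster measure `φ = rcMeasure G p q ∅` on ANY finite graph (`0 < p < 1`,
`0 < q`): opening the contact edge `e` of a split configuration with a trail-to-trail contact
produces a joined configuration of weight `φ(ω ∪ e) = (p / ((1-p) q)) φ(ω)` whose ONLY separating
bridge is `e` (any other bridge `b` leaves `a0 — trail — u — e — v — trail — a2` intact), so the map
`(ω, e) ↦ ω ∪ e` is injective onto joined configurations and
`(p/((1-p)q)) · φ{Split ∧ TrailContact} ≤ φ{AllJoined}`. Finite combinatorics; provable now. -/
/- PROOF OUTLINE for `trailContactSurgery` (for the crux-plan / prover seat).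
(1) Combinatorial core (no measure): if ω ∈ Split a with trail-contact e = s(u,v) (u on an open
    edge-simple trail γ₀₁ : a0 → a1, v on γ₂₃ : a2 → a3, e ∉ ω, G.Adj u v) then
    (i)  ω ∪ {e} ∈ AllJoined a (a0 –γ₀₁– u –e– v –γ₂₃– a2, etc.);
    (ii) e merges two distinct clusters (u ∈ C(a0) ∌ a2 ∋ ... v ∈ C(a2)), so
         clusterCount (ω ∪ {e}) ∅ + 1 = clusterCount ω ∅, #(ω∪{e}) = #ω + 1;
    (iii) INJECTIVITY: if ω₁, ω₂ ∈ Split a with trail-contacts e₁, e₂ and ω₁ ∪ {e₁} = ω₂ ∪ {e₂} =: ω'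
         then e₁ = e₂ (hence ω₁ = ω₂). Indeed if e₂ ≠ e₁ then e₂ ∈ ω₁ and ω₂ = ω' ∖ {e₂}:
         – e₂ ∉ γ₀₁ ∪ γ₂₃: both trails and e₁ survive in ω₂, so a0 ↔ a2 in ω₂, contradicting Split;
         – e₂ ∈ γ₀₁ (edge-simple, so removing e₂ cuts γ₀₁ into an a0-piece and an a1-piece; γ₂₃ ⊆ C(a2)
           is untouched): if u lies on the a0-piece then a0 ↔ u ↔ v ↔ a2 in ω₂; if on the a1-piece then
           a1 ↔ a2 in ω₂ and Split's a0 ↔ a1 would give a0 ↔ a2; either way ω₂ ∉ Split; – e₂ ∈ γ₂₃: same.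
(2) Measure: by `rcMeasure_real_eq_sum_indicator_mul` both sides are finite sums of w(ω)/Z over
    ω ⊆ E(G); by (ii) and the definition of `rcWeight`, w(ω ∪ {e}) = (p/((1-p) q)) · w(ω) for
    0 < p < 1, 0 < q; choose one contact e(ω) per ω ∈ Split ∩ TrailContact; by (i),(iii) the map
    ω ↦ ω ∪ {e(ω)} is an injection into AllJoined, so (p/((1-p)q)) Σ_{Split∩TC} w ≤ Σ_{AllJoined} w.
(3) The coupling version used by the idea (sourced Lupu–Werner space (n, ξ), flip ξ_e, weight ratio
    e^β − 1, Euler trails of the odd(n)-clusters) is the same argument with γ's taken inside odd(n) ⊆ V ∖ {b}. -/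
theorem trailContactSurgery {V : Type*} [Fintype V] [DecidableEq V] (G : SimpleGraph V)
    [DecidableRel G.Adj] {p q : ℝ} (hp : p ∈ Set.Ioo (0 : ℝ) 1) (hq : 0 < q) (a : Fin 4 → V) :
    p / ((1 - p) * q) * (rcMeasure G p q ∅).real {ω | Split ω a ∧ TrailContact G ω a} ≤
      (rcMeasure G p q ∅).real {ω | AllJoined ω a} := by
  sorry

/-- The transfer target of idea `loop-cluster-adjacency-surgery`, stated over the tree's sourced
loop-O(1) measure `loopO1Measure G t A` (law `∝ t^{|F|} 1[∂F = A]`, `LoopO1.lean`) at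
`t = tanh β_c(3)` on the crux's box graph with sources the four corners of `A_l`:
**LoopClustersTouch** — with probability `≥ c`, uniformly in `l` and large `N`, the `F`-cluster of
`a 0` either contains all four sources or is at lattice distance `1` from ANOTHER source-carrying
`F`-cluster (the cluster of the other pair). Via the sourced Lupu–Werner coupling `φ_N[· | F_A] = trace(n^A) ∨ Bern(1-e^{-β})`
with `odd(n^A) ~ ℓ^A`, Euler trails of the `F`-clusters, `trailContactSurgery` on the coupling
space and Griffiths `⟨σ_A⟩ ≥ ⟨σ_{a0}σ_{a1}⟩⟨σ_{a2}σ_{a3}⟩`, it gives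
`P4 ≥ (1 - e^{-β_c}) · φ_N[a0↔a1] φ_N[a2↔a3] · c`, i.e. `FKFourConnectivity`. -/
def LoopClustersTouch : Prop :=
  ∃ c : ℝ, 0 < c ∧ ∀ l : ℕ, 1 ≤ l → ∃ N₀ : ℕ, ∀ N : ℕ, N₀ ≤ N → ∀ a : Fin 4 → BoxV N,
    (∀ i, ((a i : Site 3)) = (l : ℤ) • tetra i) →
      c ≤ (loopO1Measure (boxGraph N) (Real.tanh (criticalBeta 3)) (Finset.univ.image a)).real
        {F | (∀ i, (openGraph F).Reachable (a 0) (a i)) ∨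
          ∃ u v : BoxV N, (boxGraph N).Adj u v ∧ (openGraph F).Reachable (a 0) u ∧
            ¬ (openGraph F).Reachable (a 0) v ∧ ∃ i, (openGraph F).Reachable (a i) v}

/-- `k` vertex-disjoint open clusters cross the annulus `A(r,R)` of the box (centre `0`): there are
`k` points of sup-norm `≤ r`, pairwise NOT connected, each connected to a point of sup-norm `≥ R`. -/
def DisjointCrossings {N : ℕ} (ω : BondConfig (BoxV N)) (k r R : ℕ) : Prop :=
  ∃ x : Fin k → BoxV N, (∀ i, ∀ t : Fin 3, |(x i : Site 3) t| ≤ r) ∧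
    (∀ i j, i ≠ j → ¬ (openGraph ω).Reachable (x i) (x j)) ∧
    ∀ i, ∃ y : BoxV N, (∃ t : Fin 3, (R : ℤ) ≤ |(y : Site 3) t|) ∧ (openGraph ω).Reachable (x i) y

/-- **First lemma of idea `disjoint-crossing-tails` (free-measure cluster-BK by induction).**
`φ⁰_N[≥ k disjoint clusters cross A(r,R)] ≤ (φ⁰_N[A(r,R) is crossed])^k`: explore the crossing
clusters one at a time; off an explored cluster `C` the conditional law is the FREE measure of
`Λ_N ∖ C` (free domain Markov, `rcMeasure_real_free_restrict_inter_outerClosed`), which is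
dominated on increasing events by `φ⁰_N` (`rcMeasure_real_free_le_restrict`, `q ≥ 1`). A BK
substitute valid for every `q ≥ 1`; provable now from the tree. -/
theorem disjointCrossingTail (N k r R : ℕ) :
    (phiN N).real {ω | DisjointCrossings ω k r R} ≤
      ((phiN N).real {ω | DisjointCrossings ω 1 r R}) ^ k := by
  sorry

/-- The `k = 2` pointed version (distinct arms cost the product): for any two vertices `x y` and
target sets, `φ⁰_N[x ↔ S and y ↔ T in DIFFERENT clusters] ≤ φ⁰_N[x ↔ S] · φ⁰_N[y ↔ T]`. With
`S = T =` the complement of the two balls of radius `r = |x-y|/2` and FKG this yields the rigorous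
two-arm gluing bound `φ[x ↔ y | both arms] ≥ G(x,y)/(G(x,y) + π_r(x)π_r(y))` of the notes. -/
theorem twoArmGluing (N : ℕ) (x y : BoxV N) (S T : Set (BoxV N)) :
    (phiN N).real {ω | (∃ s ∈ S, (openGraph ω).Reachable x s) ∧ (∃ t ∈ T, (openGraph ω).Reachable y t)
        ∧ ¬ (openGraph ω).Reachable x y} ≤
      (phiN N).real {ω | ∃ s ∈ S, (openGraph ω).Reachable x s} *
        (phiN N).real {ω | ∃ t ∈ T, (openGraph ω).Reachable y t} := by
  sorry

/-- Transfer target of idea `disjoint-crossing-tails`: **AnnulusNotSure** — the critical FK-Ising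
annulus `A(εl, l)` is NOT crossed with probability bounded below (one number `θ < 1`). With
`disjointCrossingTail` it gives exponential tails for the number of macroscopic clusters, the
cluster-count half of FK hyperscaling (BCKS-type second moment then yields the spatially averaged
form of the crux; the pointwise form needs in addition a corner gluing device). -/
def AnnulusNotSure : Prop :=
  ∃ ε θ : ℝ, 0 < ε ∧ θ < 1 ∧ ∀ l : ℕ, 1 ≤ l → ∃ N₀ : ℕ, ∀ N : ℕ, N₀ ≤ N →
    (phiN N).real {ω | DisjointCrossings ω 1 ⌊ε * l⌋₊ l} ≤ θ

/-- Sanity: the crux decl is in scope (the line's composition theorem will conclude it by name). -/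
example : Prop := Summit.CriticalPhenomena.Ising3DConformalLimit.Theses.FKParityRobustness.FKFourConnectivity

end Summit.CriticalPhenomena.Ising3DConformalLimit.Cruxes.FKFourConnectivity.Sketch

end
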